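/-
Copyright (c) 2026 the pub-hodgecm-mathlib formalisation cell (harness21).  Prover seat hodgecm-mathlib-LH3-p01 (g7); dealer LH4-plan (g7) WORD #35 (ii) «(C5)′
`…CountJPosTrace`» (second half, the literal), 2026-09-02.  Count-neutral LAYER C of the dyadic (D-UNR) column; CENSUS-C5 bd72510a row `CountJPosTorus`, (D1).
-/
import Literature.NumberTheory.Rogawski1990.UnitOrbitalIntegralInertCountJPosTrace     -- (C5)′ first half: the dispatcher `natCard_cosets_eq_iTen_of_rel`, §2b `v_eq_of_v_sub_lt_v_traceDefect`
import HarnessLib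

/-!
# Flicker's PROPOSITION 10 AT THE TRACE LITERAL `M_{b,π₁}(x₁,x₂,x₃)` with a free level `|π₁| = |ϖ^j|`, `1 ≤ j ≤ N` — every residue characteristic
# (Flicker 1998 Prop. 10, Cor. 9; LAYER C (C5)′ of the dyadic (D-UNR) column)

Topic `NumberTheory/Rogawski1990`; namespace `Literature.NumberTheory.Automorphic.UnitaryGroup`.  THEOREMS ONLY (no definition, no instance, no notation, no named fact,
no `sorry`); count-neutral; kernel lane `--supports stmt-HodgeConjecture-24833`.  Twin of ★ `UnitOrbitalIntegralInertCountJPosTorus.natCard_cosets_flickerTorus_eq_iTen` with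
`h2e : 2e = 1`, `hy : yσy = −2`, `|2| = 1` GONE: the torus element is ★ F1 p851889's trace block `M_{b,π₁,π₁′}(x₁,x₂,x₃)` (`b + σb = 1`, `|b| ≤ 1`, `π₁π₁′ = 1`, `σπ₁ = π₁`,
`|π₁| = |ϖ^j|` — by the first half's §2 this covers every radial conjugate `r_i⁻¹ M_{b,ϖ^ε} r_i`, `j = 2i + ε`, CENSUS (D1′)); the invariants are `N = ord(x₁ − x₃)` and the
diagonal defect `N₊ = ord((x₁−x₂)σb + (x₃−x₂)b)`; the generic tokens of the dispatcher are discharged as `p := π₁²∕(bσb)` (`σp = p`, `|p| = |ϖ^{2j}| < 1`),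
`|A − D| = |x₁−x₃|·|σb − b| ≤ |ϖ^N| < |B₂| = |ϖ^{N−j}|`, and the fourth-regime σ-defect by the EXACT identity `(A−e)∕B₂ − σ((D−e)∕B₂) = (x₁−e)(e−x₃)∕(e·B₂)` (§1,
F0P3a-p09's (C3c) letter; `= |ϖ^{N₁+N₂−ν}|` with `N₁ = N₂ = N₊` from the first half's §2b).  Prop. 8's numbers stay hypotheses (★ `…CountJPos` precedent; (C2)′ discharges).
RHS `iTen q (N − j) N₊ m` VERBATIM.
HONEST READER LABEL: HC_CM is proved only modulo the 7 printed citations (2 remaining named inputs: hLiu418 = stmt-HodgeConjecture-24832, h413 = stmt-HodgeConjecture-24833) until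
rung 0 closes; count-neutral ((D-UNR) stays PRINT by D74′), pays no organ, opens no road.

## References
* [Flicker1998UnitaryFL] Y. Z. Flicker, *Elementary proof of the fundamental lemma for a unitary group*, Canad. J. Math. 50 (1998), Prop. 10 pp. 85–86, Cor. 9 p. 85.
* [Rogawski1990] J. D. Rogawski, *Automorphic Representations of Unitary Groups in Three Variables* (1990), §4.9 p. 55.
-/

set_option autoImplicit false

open scoped MatrixGroups WithZero Valued
open Matrix

namespace Literature.NumberTheory.Automorphic

namespace UnitaryGroup

open Literature.NumberTheory.Automorphic.HermitianLattice (unitaryInt UnramifiedLocalConjDatum)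
open Literature.NumberTheory.Rogawski1990.Flicker1998 (iTen)
open IsLocalRing

variable {K : Type*} [Field K] [Valued K ℤᵐ⁰] {ϖ : K} (σ : K →+* K) {J : Matrix (Fin 3) (Fin 3) K}

section Torus

variable [IsDiscreteValuationRing 𝒪[K]] [Finite (ResidueField 𝒪[K])] [IsAdicComplete (maximalIdeal 𝒪[K]) 𝒪[K]]

/-! ## §1 The σ-defect of the trace corner; §2 Prop. 10 at the trace literal -/

omit [IsDiscreteValuationRing 𝒪[K]] [Finite (ResidueField 𝒪[K])] [IsAdicComplete (maximalIdeal 𝒪[K]) 𝒪[K]] [Valued K ℤᵐ⁰] in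
/-- **The σ-defect of the trace corner, EXACTLY** (F0P3a-p09's (C3c) identity): with `A − e = (x₁−e)σb + (x₃−e)b`, `D − e = (x₁−e)b + (x₃−e)σb`,
`B₂ = π₁′·bσb·(x₁−x₃)` (norm-one `x₁, e, x₃`, `b + σb = 1`, `σπ₁′ = π₁′`): `(A − e)∕B₂ − σ((D − e)∕B₂) = (x₁ − e)(e − x₃)∕(e·B₂)` — by `b + σb = 1`, not `2e = 1`.
[cite: Flicker1998UnitaryFL, Prop. 10 p. 86] -/
theorem traceCorner_defect_ratio_sub_map (hσσ : ∀ a, σ (σ a) = a) {b π₁' x₁ e x₃ : K} (hb : b + σ b = 1) (hb0 : b ≠ 0) (hσb0 : σ b ≠ 0)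
    (hσπ' : σ π₁' = π₁') (hπ0 : π₁' ≠ 0) (hx₁ : σ x₁ * x₁ = 1) (he : σ e * e = 1) (hx₃ : σ x₃ * x₃ = 1) (h13 : x₁ ≠ x₃) :
    (x₁ * σ b + x₃ * b - e) / (π₁' * (b * σ b * (x₁ - x₃))) - σ ((x₁ * b + x₃ * σ b - e) / (π₁' * (b * σ b * (x₁ - x₃)))) =
      (x₁ - e) * (e - x₃) / (e * (π₁' * (b * σ b * (x₁ - x₃)))) := by
  have hx0 : x₁ ≠ 0 := fun h => by rw [h, mul_zero] at hx₁; exact zero_ne_one hx₁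
  have he0 : e ≠ 0 := fun h => by rw [h, mul_zero] at he; exact zero_ne_one he
  have hx30 : x₃ ≠ 0 := fun h => by rw [h, mul_zero] at hx₃; exact zero_ne_one hx₃
  have hσx₁ : σ x₁ = x₁⁻¹ := eq_inv_of_mul_eq_one_left hx₁
  have hσe : σ e = e⁻¹ := eq_inv_of_mul_eq_one_left he
  have hσx₃ : σ x₃ = x₃⁻¹ := eq_inv_of_mul_eq_one_left hx₃
  have hσb : σ b = 1 - b := by linear_combination hb
  have h1b : (1 : K) - b ≠ 0 := by rw [← hσb]; exact hσb0
  have h13' : x₁ - x₃ ≠ 0 := sub_ne_zero.2 h13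
  have h31' : x₃ - x₁ ≠ 0 := sub_ne_zero.2 (Ne.symm h13)
  simp only [map_div₀, map_mul, map_sub, map_add, hσσ, hσπ', hσx₁, hσe, hσx₃]
  rw [hσb]
  field_simp
  ring

/-- **FLICKER'S PROPOSITION 10 AT THE TRACE LITERAL** (`1 ≤ j ≤ N`): for `t = M_{b,π₁,π₁′}(x₁,x₂,x₃) = !![x₁σb + x₃b, 0, π₁(x₁−x₃); 0, x₂, 0; π₁′bσb(x₁−x₃), 0,
x₁b + x₃σb] ∈ H` (★ F1's trace torus block; `b + σb = 1`, `|b| ≤ 1`, `π₁π₁′ = 1`, `σπ₁ = π₁`, `|π₁| = |ϖ^j|` — so `t` is the radial conjugate `r_i⁻¹ M_{b,ϖ^ε} r_i`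
with `j = 2i + ε` by §2), norm-one `x₁, x₂, x₃` with `|x₁ − x₃| = |ϖ^N|` and diagonal defect `|(x₁−x₂)σb + (x₃−x₂)b| = |ϖ^{N₊}|`:
`#{y ∈ P_H ⧸ (P_H ∩ H^K_m) : y⁻¹ t y ∈ H^K_m} = iTen q (N − j) N₊ m` — twin of ★ `natCard_cosets_flickerTorus_eq_iTen` with `h2e`, `hy : yσy = −2`, `|2| = 1` GONE
(`N₁ = N₂ = N₊` in the fourth regime is §2b's 2-free reading; the σ-defect is `traceCorner_defect_ratio_sub_map`).  Prop. 8's numbers (`hidx0 hidx hSN hfib`) are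
hypotheses as in ★ `…CountJPos` (the (C2)′ package discharges them). [cite: Flicker1998UnitaryFL, Prop. 10 pp. 85–86; Cor. 9 p. 85] -/
theorem natCard_cosets_traceTorus_eq_iTen_of_rel (hJ : J = (StdForm.antidiagonal 3).over K) (hd : UnramifiedLocalConjDatum σ ϖ) (h2 : (2 : K) ≠ 0)
    (hσO : ∀ y : 𝒪[K], (σ.comp 𝒪[K].subtype) y ∈ 𝒪[K]) {y z : K} (hy : Valued.v y = 1) (hzv : Valued.v z ≤ 1) (hz : z + σ z + y * σ y = 0)
    {m : ℕ} {c um t : ↥(unitaryGroupOfForm σ J)} (hc : ((c : GL (Fin 3) K) : Matrix (Fin 3) (Fin 3) K) = !![1, 0, 0; 0, -1, 0; 0, 0, 1])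
    (hum : ((um : GL (Fin 3) K) : Matrix (Fin 3) (Fin 3) K) = !![ϖ ^ m, y, z * (ϖ ^ m)⁻¹; 0, 1, -σ y * (ϖ ^ m)⁻¹; 0, 0, (ϖ ^ m)⁻¹])
    {b π₁ π₁' x₁ x₂ x₃ : K} (hb : b + σ b = 1) (hbv : Valued.v b ≤ 1) (hππ : π₁ * π₁' = 1) (hσπ : σ π₁ = π₁)
    {j : ℕ} (hπj : Valued.v π₁ = Valued.v (ϖ ^ j))
    (hx₁ : σ x₁ * x₁ = 1) (hx₂ : σ x₂ * x₂ = 1) (hx₃ : σ x₃ * x₃ = 1)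
    (hte : ((t : GL (Fin 3) K) : Matrix (Fin 3) (Fin 3) K) =
      !![x₁ * σ b + x₃ * b, 0, π₁ * (x₁ - x₃); 0, x₂, 0; π₁' * (b * σ b * (x₁ - x₃)), 0, x₁ * b + x₃ * σ b])
    (htH : t ∈ Subgroup.centralizer ({c} : Set ↥(unitaryGroupOfForm σ J)))
    {N Np : ℕ} (hN : Valued.v (x₁ - x₃) = Valued.v (ϖ ^ N)) (hNp : Valued.v ((x₁ - x₂) * σ b + (x₃ - x₂) * b) = Valued.v (ϖ ^ Np))
    (hj : 1 ≤ j) (hjN : j ≤ N)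
    {q : ℕ} (hq : Nat.card (ResidueField 𝒪[K]) = q ^ 2)
    {a₀ : 𝒪[K]} (ha₀ : IsUnit (((σ.comp 𝒪[K].subtype).codRestrict 𝒪[K] hσO) a₀ - a₀))
    (hidx0 : m = 0 → ((flickerHK σ J c um).subgroupOf (flickerPH σ J c)).index = 1)
    (hidx : 1 ≤ m → ((flickerHK σ J c um).subgroupOf (flickerPH σ J c)).index = (q ^ 2 - 1) * q ^ (4 * m - 2))
    (hSN : flickerPH σ J c ⊓ flickerHK σ J c um ≤ flickerPH0 σ J c (ϖ ^ m))
    [Finite (↥(flickerPH σ J c) ⧸ (flickerHK σ J c um).subgroupOf (flickerPH σ J c))]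
    (hfib : ∀ z ∈ Set.range (fun w : ↥(flickerPH σ J c) ⧸ (flickerHK σ J c um).subgroupOf (flickerPH σ J c) =>
        flickerPHRho σ m ((Quotient.out w : ↥(flickerPH σ J c)) : ↥(unitaryGroupOfForm σ J))),
      Nat.card {w : ↥(flickerPH σ J c) ⧸ (flickerHK σ J c um).subgroupOf (flickerPH σ J c) //
        flickerPHRho σ m ((Quotient.out w : ↥(flickerPH σ J c)) : ↥(unitaryGroupOfForm σ J)) = z} = q ^ m) :
    (Nat.card {w : ↥(flickerPH σ J c) ⧸ (flickerHK σ J c um).subgroupOf (flickerPH σ J c) //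
      ((Quotient.out w : ↥(flickerPH σ J c)) : ↥(unitaryGroupOfForm σ J))⁻¹ * t * (Quotient.out w : ↥(flickerPH σ J c)) ∈ flickerHK σ J c um} : ℚ) =
      iTen q (N - j) Np m := by
  have hϖ0 : ϖ ≠ 0 := hd.ϖ_ne_zero
  -- units: `b, σb, x_i, π₁, π₁′`
  obtain ⟨hvb, hvσb, hvbσb⟩ := v_eq_one_of_add_map_eq_one σ hd.vσ hbv hb
  have hb0 : b ≠ 0 := fun h => by rw [h, map_zero] at hvb; exact zero_ne_one hvb
  have hσb0 : σ b ≠ 0 := fun h => by rw [h, map_zero] at hvσb; exact zero_ne_one hvσb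
  have hx10 : x₁ ≠ 0 := fun h => by rw [h, mul_zero] at hx₁; exact zero_ne_one hx₁
  have hx20 : x₂ ≠ 0 := fun h => by rw [h, mul_zero] at hx₂; exact zero_ne_one hx₂
  have hx30 : x₃ ≠ 0 := fun h => by rw [h, mul_zero] at hx₃; exact zero_ne_one hx₃
  have hπ0 : π₁ ≠ 0 := fun h => by rw [h, zero_mul] at hππ; exact zero_ne_one hππ
  have hπ'e : π₁' = π₁⁻¹ := eq_inv_of_mul_eq_one_right hππ
  have hπ'0 : π₁' ≠ 0 := by rw [hπ'e]; exact inv_ne_zero hπ0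
  have hσπ' : σ π₁' = π₁' := by rw [hπ'e, map_inv₀, hσπ]
  have hvx₂ : Valued.v x₂ = 1 := by
    have h1 := congrArg Valued.v hx₂; rw [map_mul, hd.vσ, map_one] at h1
    exact Literature.NumberTheory.QuadraticForms.OMeara65.WithZeroMulInt.eq_one_of_mul_self h1
  have h13 : x₁ ≠ x₃ := by
    intro h; rw [h, sub_self, map_zero] at hN; exact (pow_ne_zero _ hϖ0) ((map_eq_zero _).1 hN.symm)
  -- the generic tokens: `p := π₁²∕(bσb)`
  have hB₁ : π₁ * (x₁ - x₃) = π₁' * (b * σ b * (x₁ - x₃)) * (π₁ * π₁ / (b * σ b)) := by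
    field_simp
    linear_combination hππ.symm
  have hvp : Valued.v (π₁ * π₁ / (b * σ b)) < 1 := by
    rw [map_div₀, map_mul, hvbσb, div_one, hπj, ← map_mul, ← pow_add]
    exact hd.v_pow_le_one _ |>.lt_of_ne (by rw [Ne, hd.v_pow, ← WithZero.exp_zero, WithZero.exp_inj]; omega)
  have hσp : σ (π₁ * π₁ / (b * σ b)) = π₁ * π₁ / (b * σ b) := by
    rw [map_div₀, map_mul, map_mul, hσπ, hd.σσ, mul_comm (σ b) b]
  have hB₂ : Valued.v (π₁' * (b * σ b * (x₁ - x₃))) = Valued.v (ϖ ^ (N - j)) := by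
    rw [map_mul, map_mul, hvbσb, one_mul, hπ'e, map_inv₀, hπj, hN, hd.v_pow, hd.v_pow, hd.v_pow, ← WithZero.exp_neg, ← WithZero.exp_add]
    congr 1
    push_cast [Nat.cast_sub hjN]
    ring
  have hs : Valued.v (x₁ * σ b + x₃ * b - x₂) = Valued.v (ϖ ^ Np) := by
    rw [show x₁ * σ b + x₃ * b - x₂ = (x₁ - x₂) * σ b + (x₃ - x₂) * b by linear_combination x₂ * hb, hNp]
  have hAD : Valued.v ((x₁ * σ b + x₃ * b) - (x₁ * b + x₃ * σ b)) < Valued.v (π₁' * (b * σ b * (x₁ - x₃))) := by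
    rw [show (x₁ * σ b + x₃ * b) - (x₁ * b + x₃ * σ b) = (x₁ - x₃) * (σ b - b) by ring, map_mul, hB₂, hN]
    have hsb : Valued.v (σ b - b) ≤ 1 := le_trans (Valuation.map_sub _ _ _) (max_le hvσb.le hvb.le)
    calc Valued.v (ϖ ^ N) * Valued.v (σ b - b) ≤ Valued.v (ϖ ^ N) * 1 := by gcongr
      _ = Valued.v (ϖ ^ N) := mul_one _
      _ < Valued.v (ϖ ^ (N - j)) := by rw [v_pow_lt_v_pow_iff_of_unramified σ hd]; omega
  -- the σ-defect in the fourth regime: `= |ϖ^{N₁+N₂−ν}| = |ϖ^{N₊}| ≤ |ϖ^{2m−N₊}|`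
  have hσd : Np = N - j → m ≤ N - j → N - j < 2 * m →
      Valued.v (σ ((x₁ * σ b + x₃ * b - x₂) / (π₁' * (b * σ b * (x₁ - x₃)))) - (x₁ * b + x₃ * σ b - x₂) / (π₁' * (b * σ b * (x₁ - x₃)))) ≤
        Valued.v (ϖ ^ (2 * m - (N - j))) := by
    intro hNpν hmν _
    -- `N₁ = N₂ = N₊` (2-free, §2b) since `N₊ = ν < N`
    have hlt : Valued.v (x₁ - x₃) < Valued.v ((x₁ - x₂) * σ b + (x₃ - x₂) * b) := by
      rw [hN, hNp, v_pow_lt_v_pow_iff_of_unramified σ hd]; omega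
    obtain ⟨hN₁, hN₂⟩ := v_eq_of_v_sub_lt_v_traceDefect σ hd.vσ hb hbv hlt
    rw [hNp] at hN₁ hN₂
    -- the identity, conjugated
    have key := traceCorner_defect_ratio_sub_map σ hd.σσ hb hb0 hσb0 hσπ' hπ'0 hx₁ hx₂ hx₃ h13
    have e1 : σ ((x₁ * σ b + x₃ * b - x₂) / (π₁' * (b * σ b * (x₁ - x₃)))) - (x₁ * b + x₃ * σ b - x₂) / (π₁' * (b * σ b * (x₁ - x₃))) =
        σ ((x₁ - x₂) * (x₂ - x₃) / (x₂ * (π₁' * (b * σ b * (x₁ - x₃))))) := by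
      rw [← key, map_sub, hd.σσ]
    rw [e1, hd.vσ, map_div₀, map_mul, map_mul, hvx₂, one_mul, hB₂, hN₁, show x₂ - x₃ = -(x₃ - x₂) by ring, Valuation.map_neg, hN₂,
      ← hNpν, div_eq_mul_inv, ← map_mul, ← map_inv₀, ← map_mul, show ϖ ^ Np * ϖ ^ Np * (ϖ ^ Np)⁻¹ = ϖ ^ Np by field_simp,
      v_pow_le_v_pow_iff_of_unramified σ hd]
    omega
  exact natCard_cosets_eq_iTen_of_rel σ hJ hd h2 hσO hy hzv hz hc hum hB₁ hvp hσp hte htH hB₂ hs hAD hσd hq ha₀ hidx0 hidx hSN hfib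


end Torus

end UnitaryGroup

end Literature.NumberTheory.Automorphic
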